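import Literature.NumberTheory.Sieve.MontgomeryVaughan1975Lemma43Assembly
import Literature.NumberTheory.Sieve.MontgomeryVaughan1975Section6ExcMain
import Literature.NumberTheory.Sieve.LuGoldbachExceptionalSetProofs
import HarnessLib

/-!
# Montgomery–Vaughan (1975): decomposition of (8.3) and of Theorem 1 into the explicit formulae
# and Gallagher's log-free zero-density estimate with the Deuring–Heilbronn factor

Decomposition record (librarian, mode `fact-decompose`, 2026-08-16) for the two XL named facts of
H. L. Montgomery, R. C. Vaughan, *The exceptional set in Goldbach's problem*, Acta Arith. 27 (1975)
353–370 [MontgomeryVaughanActa1975] still open in the tree: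

* `Literature.NumberTheory.Sieve.MontgomeryVaughan1975.majorArc_lowerBound` — (8.3), the major-arc
  lower bound off a small set;
* `Literature.NumberTheory.Sieve.goldbachExceptionalCount_isBigO_rpow` — Theorem 1 (parity.S15),
  `E(X) ≪ X^{1−δ}`.

**State of the tree.** Theorem 1 follows from (8.3) alone
(`goldbachExceptionalCount_isBigO_rpow_of_majorArc_mv`: minor arcs, §§5–8 proved); (8.3) follows
from LEMMA 4.3 (= Gallagher 1970, Thm. 7, modified) alone (`majorArc_lowerBound_of_lemma43`:
Lemmas 4.1, 4.2, §§5–8 and `section6_formulae` proved); and LEMMA 4.3 follows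
(`lemma43_gallagher_of_explicitFormula_of_density`, `MontgomeryVaughan1975Lemma43Assembly`) from
(i) the truncated explicit formulae MNT I Thm. 12.10 / Thm. 12.5 — the existing named facts
`Literature.NumberTheory.LFunctions.truncatedExplicitFormula_psiChar`,
`Literature.NumberTheory.LFunctions.truncatedExplicitFormula_psi` — and (ii) a LOG-FREE
ZERO-DENSITY ESTIMATE for the family of primitive `χ` mod `q ≤ P` at height `P⁶`, together with
its Deuring–Heilbronn sharpening in the presence of an exceptional zero (Gallagher 1970, Thm. 6;
Bombieri, *Le grand crible*, Thm. 14), which entered that theorem as four explicit binders.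

**Decision: SPLIT both facts into the same three children + proved glue.**

* child 1 (existing): `truncatedExplicitFormula_psiChar` [cite: MontgomeryVaughan2007, Theorem 12.10];
* child 2 (existing): `truncatedExplicitFormula_psi` [cite: MontgomeryVaughan2007, Theorem 12.5];
* child 3 (new): `MontgomeryVaughan1975.gallagher1970_logFreeDensity` — Gallagher's log-free density
  estimate with the Deuring–Heilbronn factor, packaging the four binders `hZDζ, hZD, hDHζ, hDH` of
  `lemma43At_of_explicitFormula_of_density` with their shared constants `c_D, C_D, c_H`;
* glue (proved): `lemma43_gallagher_holds_of`, `majorArc_lowerBound_holds_of`,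
  `goldbachExceptionalCount_isBigO_rpow_holds_of` (children 1–3 ⇒ Lemma 4.3 ⇒ (8.3) ⇒ Thm. 1).

None of the children restates a parent: children 1–2 are explicit formulae for `ψ(x, χ)`, `ψ(x)`;
child 3 is a statement about counts of zeros of Dirichlet `L`-functions (no Goldbach problem, no
major arcs). Size of child 3: L (Gallagher's Thm. 6 via Turán's power sums or Bombieri's
large-sieve proof, plus the Deuring–Heilbronn repulsion; the tree has the large sieve, Huxley /
Ingham / Guth–Maynard zero-density files and `MontgomeryVaughan1975BoxZeros`).

## References

* H. L. Montgomery, R. C. Vaughan, Acta Arith. 27 (1975), §4 Lemma 4.3, §8 (8.3), Theorem 1.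
  [MontgomeryVaughanActa1975]
* P. X. Gallagher, *A large sieve density estimate near `σ = 1`*, Invent. Math. 11 (1970) 329–339,
  Thm. 6 and Thm. 7. [Gallagher1970Density]
* E. Bombieri, *Le grand crible dans la théorie analytique des nombres*, Astérisque 18 (2nd ed.
  1987), §6, Théorème 14. [Bombieri1987GrandCrible]
* H. L. Montgomery, R. C. Vaughan, *Multiplicative Number Theory I*, CUP 2007, Thm. 12.5,
  Thm. 12.10. [MontgomeryVaughan2007]
-/

noncomputable section

open Finset Real

namespace Literature.NumberTheory.Sieve.MontgomeryVaughan1975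

open Literature.NumberTheory.LFunctions

open scoped Classical in
/-- **Gallagher's log-free zero-density estimate with the Deuring–Heilbronn factor** (Gallagher
1970, Thm. 6; Bombieri, *Le grand crible*, Thm. 14 — named fact, child 3 of the decomposition of
`lemma43_gallagher` / `majorArc_lowerBound` / `goldbachExceptionalCount_isBigO_rpow`), in the currency
of `lemma43At_of_explicitFormula_of_density` (whose four density binders it packages, with shared
constants): there are `c_D, C_D, c_H > 0` such that for every `P ≥ 2` and `0 ≤ α ≤ 1`,
(ζ) over any admissible finite indexing of the zeros of `ζ` of height `≤ P⁶`
(`weilZeroIndex_finite`, multiplicities `riemannZetaZeroOrder`), `∑_{Re ρ ≥ α} m(ρ) ≤ C_D P^{c_D(1−α)}`;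
(χ) over arbitrary finite sets `Z(q, χ)` of non-trivial zeros of `L(s, χ)` of height `≤ P⁶`,
`∑_{q ≤ P} ∑_{χ mod q primitive} ∑_{ρ ∈ Z(q,χ), Re ρ ≥ α} m_χ(ρ) ≤ C_D P^{c_D(1−α)}`
(`DirichletDisc.zeroOrder`) — "`∑_{q ≤ T} ∑*_χ N(α, T, χ) ≪ T^{c(1−α)}`" at `T = P⁶`; and
(Deuring–Heilbronn) if `β̃` is an exceptional zero at level `c_H` (`IsExceptionalZero c_H P r χ̃ β̃`:
a real zero `β̃ ≥ 1 − c_H/log P` of a primitive `χ̃ ≠ 1` mod `r ≤ P`), the same two sums, the second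
WITHOUT the term `(r, χ̃, β̃)` itself, are bounded by `C_D (1 − β̃)(log P) P^{c_D(1−α)}` (Bombieri,
Thm. 14, second part). [cite: Gallagher1970Density, Theorem 6] [cite: Bombieri1987GrandCrible, §6 Théorème 14] -/
def gallagher1970_logFreeDensity : Prop :=
  ∃ c_D C_D cH : ℝ, 0 < c_D ∧ 0 < C_D ∧ 0 < cH ∧
    (∀ P : ℝ, 2 ≤ P → ∀ α : ℝ, 0 ≤ α → α ≤ 1 →
      ∑ ρ ∈ (weilZeroIndex_finite (P ^ 6)).toFinset with α ≤ ρ.re,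
        ((riemannZetaZeroOrder ρ : ℤ) : ℝ) ≤ C_D * P ^ (c_D * (1 - α))) ∧
    (∀ P : ℝ, 2 ≤ P → ∀ Z : (q : ℕ) → DirichletCharacter ℂ q → Finset ℂ,
      (∀ (q' : ℕ) (χ : DirichletCharacter ℂ (q' + 1)), ∀ ρ ∈ Z (q' + 1) χ,
          χ.LFunction ρ = 0 ∧ 0 < ρ.re ∧ ρ.re < 1 ∧ |ρ.im| ≤ P ^ 6) →
      ∀ α : ℝ, 0 ≤ α → α ≤ 1 →
        ∑ q' ∈ Finset.Ico 1 ⌊P⌋₊, ∑ χ : DirichletCharacter ℂ (q' + 1) with χ.IsPrimitive,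
          ∑ ρ ∈ Z (q' + 1) χ with α ≤ ρ.re, (DirichletDisc.zeroOrder χ ρ : ℝ) ≤
            C_D * P ^ (c_D * (1 - α))) ∧
    (∀ P : ℝ, 2 ≤ P → ∀ (r : ℕ) [NeZero r] (χe : DirichletCharacter ℂ r) (β : ℝ),
      IsExceptionalZero cH P r χe β → ∀ α : ℝ, 0 ≤ α → α ≤ 1 →
        ∑ ρ ∈ (weilZeroIndex_finite (P ^ 6)).toFinset with α ≤ ρ.re,
          ((riemannZetaZeroOrder ρ : ℤ) : ℝ) ≤ C_D * ((1 - β) * Real.log P) * P ^ (c_D * (1 - α))) ∧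
    (∀ P : ℝ, 2 ≤ P → ∀ (r : ℕ) [NeZero r] (χe : DirichletCharacter ℂ r) (β : ℝ),
      IsExceptionalZero cH P r χe β → ∀ Z : (q : ℕ) → DirichletCharacter ℂ q → Finset ℂ,
      (∀ (q' : ℕ) (χ : DirichletCharacter ℂ (q' + 1)), ∀ ρ ∈ Z (q' + 1) χ,
          χ.LFunction ρ = 0 ∧ 0 < ρ.re ∧ ρ.re < 1 ∧ |ρ.im| ≤ P ^ 6) →
      ∀ α : ℝ, 0 ≤ α → α ≤ 1 →
        ∑ q' ∈ Finset.Ico 1 ⌊P⌋₊, ∑ χ : DirichletCharacter ℂ (q' + 1) with χ.IsPrimitive,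
          ∑ ρ ∈ Z (q' + 1) χ with (α ≤ ρ.re ∧
              ¬ (q' + 1 = r ∧ (∀ n : ℕ, χ (n : ZMod (q' + 1)) = χe (n : ZMod r)) ∧
                ρ = ((β : ℝ) : ℂ))),
            (DirichletDisc.zeroOrder χ ρ : ℝ) ≤
            C_D * ((1 - β) * Real.log P) * P ^ (c_D * (1 - α)))

open scoped Classical in
/-- **Glue: LEMMA 4.3 (`lemma43_gallagher`) from the three children** — the explicit formulae
(`truncatedExplicitFormula_psiChar`, `truncatedExplicitFormula_psi`) and Gallagher's log-free
density estimate with the Deuring–Heilbronn factor (`gallagher1970_logFreeDensity`); the tree's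
`lemma43_gallagher_of_explicitFormula_of_density` with its four density binders fed from child 3.
[cite: MontgomeryVaughanActa1975, §4 Lemma 4.3] [cite: Gallagher1970Density, Theorems 6 and 7] -/
theorem lemma43_gallagher_holds_of (hEF : truncatedExplicitFormula_psiChar)
    (hEFζ : truncatedExplicitFormula_psi) (hD : gallagher1970_logFreeDensity) : lemma43_gallagher := by
  obtain ⟨c_D, C_D, cH, hcD, hCD, hcH, hZDζ, hZD, hDHζ, hDH⟩ := hD
  exact lemma43_gallagher_of_explicitFormula_of_density hEF hEFζ hcD hCD hcH hZDζ hZD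
    (fun P hP r _ χe β hex α hα0 hα1 => hDHζ P hP r χe β hex α hα0 hα1)
    (fun P hP r _ χe β hex Z hZ α hα0 hα1 => hDH P hP r χe β hex Z hZ α hα0 hα1)

/-- **Glue of the decomposition of `majorArc_lowerBound` ((8.3) of Montgomery–Vaughan 1975)**:
(8.3) from the three children, through LEMMA 4.3 (`lemma43_gallagher_holds_of`) and the tree's
`majorArc_lowerBound_of_lemma43` (Lemmas 4.1–4.2, §§5–8, `section6_formulae` proved).
[cite: MontgomeryVaughanActa1975, §8 (8.3)] -/
theorem majorArc_lowerBound_holds_of (hEF : truncatedExplicitFormula_psiChar)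
    (hEFζ : truncatedExplicitFormula_psi) (hD : gallagher1970_logFreeDensity) : majorArc_lowerBound :=
  majorArc_lowerBound_of_lemma43 (lemma43_gallagher_holds_of hEF hEFζ hD)

end Literature.NumberTheory.Sieve.MontgomeryVaughan1975

namespace Literature.NumberTheory.Sieve

open MontgomeryVaughan1975 Literature.NumberTheory.LFunctions

/-- **Glue of the decomposition of `goldbachExceptionalCount_isBigO_rpow` (Montgomery–Vaughan
1975, Theorem 1, parity.S15)**: `E(X) ≪ X^{1−δ}` from the three children, through (8.3)
(`majorArc_lowerBound_holds_of`) and the tree's `goldbachExceptionalCount_isBigO_rpow_of_majorArc_mv`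
(minor arcs and the final count proved). [cite: MontgomeryVaughanActa1975, Theorem 1] -/
theorem goldbachExceptionalCount_isBigO_rpow_holds_of (hEF : truncatedExplicitFormula_psiChar)
    (hEFζ : truncatedExplicitFormula_psi) (hD : gallagher1970_logFreeDensity) :
    goldbachExceptionalCount_isBigO_rpow :=
  goldbachExceptionalCount_isBigO_rpow_of_majorArc_mv (majorArc_lowerBound_holds_of hEF hEFζ hD)

end Literature.NumberTheory.Sieve

end
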